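import Summits.HodgeConjecture.HodgeConjecture.Theorems.Ring2AbelianAllTypeIIIFourfolds
import Summits.HodgeConjecture.HodgeConjecture.Theorems.Ring2AbelianAllWeilCellsInhabited
import Literature.AlgebraicGeometry.Motives.AimedSplitProductDischarge
import Literature.AlgebraicGeometry.HodgeTheory.WeilSurfaceCMSquare
import Literature.NumberTheory.EllipticCurves.CMEndomorphismOfMulMemLattice
import HarnessLib

/-!
# Ring 2 · AbelianAll (seat `ab-weil-2`, gen 4, file 3) — `S × E₀ × E₀`: EVERY Weil-type surface pair times the CM square
  carries a discriminant-1 Weil structure (the aiming trick one dimension down); HC for all its powers modulo Floccari–Fu alone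

HONEST FRAMING (sub-cell `pub-hodge-ring2-ab-*`, verbatim): research route, not a corollary; conditional on HC_CM plus
one named minimal statement. (Cell `pub-hodge-ring2`, verbatim: research route conditional on HC_CM; not a corollary;
Q11.4-sentence-2 already refuted in dim ≥ 3.) `HC_CM` does not occur here. No definition, no named fact, no `sorry`; the
refereed Floccari–Fu 2026 Thm. 1.2 enters as a BINDER (`h5`).

WHAT IS PROVED. Markman's "aiming" step (arXiv:2509.23403 §11.5 Step 2: multiply a polarized Weil-type `(A₁, η₁, h₁)` by a
polarized Weil-type CM SURFACE `(A₂, η₂, h₂)` chosen so that the product polarization has the split class) is in the tree for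
every even dimension (`Motives.aimedSplitProduct_cmSquare_of_pos`: for `(A, φ)` of dimension `2n` with a non-zero rational
`(n,n)` Weil class and `(E₀, ψ₀)`, `ψ₀² = -d`, the product `(A × E₀², φ × (ψ₀ × (-ψ₀)))` is HYPERBOLIC at `n + 1` for a suitable
weighted Segre polarization). The tree uses it for `n = 2` (fourfold ↦ split sixfold: the descent of fourfold Weil classes).
Here it is read at `n = 1`: for EVERY Weil-type SURFACE pair `(S, φ)` of type `(1, d)` — whatever the discriminant class of its
polarizations — and every elliptic curve `E₀` with `ψ₀ ≫ ψ₀ = -d`, the abelian FOURFOLD `S × E₀ × E₀` carries a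
`HasDiscOneWeilStructure` (`hasDiscOneWeilStructure_surface_prod_cmSquare`); hence (Floccari–Fu, refereed, binder `h5`) the
Hodge conjecture holds for ALL POWERS of `S × E₀ × E₀` (`hodgeConjectureFor_powSucc_surface_prod_cmSquare_of_floccariFu`), and
such an `E₀` exists for every `d ≥ 1` (`hodgeConjectureFor_powSucc_surface_prod_someCMSquare_of_floccariFu`, `E₀ = ℂ/ℤ[√-d]`).
So no fourfold of the shape `S × E₀²` (e.g. `S` a QM surface whose quaternion algebra contains `K = ℚ(√-d)`, or a simple CM surface
by a quartic field `L ⊃ K` with `K`-signature `(1,1)`) lies in the OPEN residual of the Weil fourfold cells `(2, d, δ ≠ [1])`: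
it is a member of such cells for some polarizations, but always also of the split cell.

## References

* [Markman2025SurveySecant] E. Markman, arXiv:2509.23403, §11.5 Step 2 (preprint; the aiming trick).
* [FloccariFu2026] S. Floccari, L. Fu, J. Math. Pures Appl. 210 (2026) 103876, Thm. 1.2.
* [vanGeemen1994HodgeAV] B. van Geemen, LNM 1594 (1994), Lemma 5.2, 5.3 and (5.4.1).
* [Schoen1998HodgeWeilAddendum] C. Schoen, Compositio Math. 114 (1998), §10.
-/

set_option linter.dupNamespace false

noncomputable section

open CategoryTheory

namespace Summit.HodgeConjecture.HodgeConjecture.Ring2.AbelianAll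

open Literature.AlgebraicGeometry Literature.AlgebraicGeometry.Motives
open Literature.AlgebraicGeometry.HodgeTheory Literature.AlgebraicGeometry.VanGeemen1994
open Literature.AlgebraicTopology.SingularHomology
open Literature.Geometry.Kaehler
open Summit.HodgeConjecture.HodgeConjecture.WeilTypeLadder
open Summit.HodgeConjecture.HodgeConjecture.Theses

/-- **`S × E₀ × E₀` carries a discriminant-1 Weil structure for EVERY Weil-type surface pair `(S, φ)`** of type `(1, d)` and
every `(E₀, ψ₀)` with `dim E₀ = 1`, `ψ₀ ≫ ψ₀ = -(d • 𝟙 E₀)`: the endomorphism `φ × (ψ₀ × (-ψ₀))` and a weighted Segre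
polarization aimed at the split class (`Motives.aimedSplitProduct_cmSquare_of_pos` at `n = 1`; the Weil class of `S` is supplied
by `isWeilType`, `exists_weilClass_of_isWeilType`). No named fact. [cite: Markman2025SurveySecant, §11.5 Step 2]
[cite: vanGeemen1994HodgeAV, Lemma 5.2 and (5.4.1)] [cite: FloccariFu2026, p. 3] -/
theorem hasDiscOneWeilStructure_surface_prod_cmSquare {S E₀ : AbelianVariety ℂ} {φ : S ⟶ S} {ψ₀ : E₀ ⟶ E₀} {d : ℕ}
    (hW : IsWeilType S φ 1 d) (hE : E₀.dim = 1) (hψ : ψ₀ ≫ ψ₀ = -(d • 𝟙 E₀)) :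
    HasDiscOneWeilStructure (S.prod (E₀.prod E₀)) := by
  obtain ⟨c, hcw, hcQ, hcH, hc0⟩ := exists_weilClass_of_isWeilType hW
  obtain ⟨e, a, ha, ha0, hhyp⟩ := aimedSplitProduct_cmSquare_of_pos hW.d_pos hE hψ hW.pos hW.dim_eq hW.sq_eq
    ⟨c, hcQ, hcH, hcw, hc0⟩
  obtain ⟨-, -, hΨ, -⟩ := exists_weilType_cmSquare hE hW.d_pos hψ
  exact ⟨_, d, e, a, hW.d_pos, prodLift_comp_self_eq_neg_nsmul hW.sq_eq hΨ, ha, ha0, hhyp⟩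

/-- **HC for ALL POWERS of `S × E₀ × E₀`, `(S, φ)` any Weil-type surface pair of type `(1, d)`, `ψ₀² = -d` on the curve `E₀`,
modulo Floccari–Fu 2026 Thm. 1.2 ALONE** (binder `h5`). [cite: FloccariFu2026, Theorem 1.2] [cite: Markman2025SurveySecant, §11.5 Step 2] -/
theorem hodgeConjectureFor_powSucc_surface_prod_cmSquare_of_floccariFu
    (h5 : FloccariFu2026_hodgeClasses_algebraic_powers_discOneWeilFourfold)
    {S E₀ : AbelianVariety ℂ} {φ : S ⟶ S} {ψ₀ : E₀ ⟶ E₀} {d : ℕ} (hW : IsWeilType S φ 1 d) (hE : E₀.dim = 1)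
    (hψ : ψ₀ ≫ ψ₀ = -(d • 𝟙 E₀)) (N : ℕ) :
    HodgeConjectureFor ((S.prod (E₀.prod E₀)).powSucc N).dim ((S.prod (E₀.prod E₀)).powSucc N).X :=
  hodgeConjectureFor_powSucc_of_floccariFu_of_hasDiscOneWeilStructure h5 (S.prod (E₀.prod E₀))
    (by rw [AbelianVariety.dim_prod, AbelianVariety.dim_prod, hW.dim_eq, hE])
    (hasDiscOneWeilStructure_surface_prod_cmSquare hW hE hψ) N

/-- The `N = 0` instance: HC for the fourfold `S × E₀ × E₀` itself, modulo Floccari–Fu. [cite: FloccariFu2026, Theorem 1.2] -/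
theorem hodgeConjectureFor_surface_prod_cmSquare_of_floccariFu
    (h5 : FloccariFu2026_hodgeClasses_algebraic_powers_discOneWeilFourfold)
    {S E₀ : AbelianVariety ℂ} {φ : S ⟶ S} {ψ₀ : E₀ ⟶ E₀} {d : ℕ} (hW : IsWeilType S φ 1 d) (hE : E₀.dim = 1)
    (hψ : ψ₀ ≫ ψ₀ = -(d • 𝟙 E₀)) :
    HodgeConjectureFor (S.prod (E₀.prod E₀)).dim (S.prod (E₀.prod E₀)).X :=
  hodgeConjectureFor_powSucc_surface_prod_cmSquare_of_floccariFu h5 hW hE hψ 0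

/-- **For every Weil-type surface pair `(S, φ)` of type `(1, d)` THERE IS an elliptic curve `E₀` (namely `ℂ/ℤ[√-d]`, with
`ψ₀ ≫ ψ₀ = -d`) such that HC holds for all powers of `S × E₀ × E₀`, modulo Floccari–Fu alone.** [cite: FloccariFu2026, Theorem 1.2]
[cite: SilvermanAEC2009, VI Thm. 4.1 (b)] -/
theorem hodgeConjectureFor_powSucc_surface_prod_someCMSquare_of_floccariFu
    (h5 : FloccariFu2026_hodgeClasses_algebraic_powers_discOneWeilFourfold)
    {S : AbelianVariety ℂ} {φ : S ⟶ S} {d : ℕ} (hW : IsWeilType S φ 1 d) :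
    ∃ (E₀ : AbelianVariety ℂ) (ψ₀ : E₀ ⟶ E₀), E₀.dim = 1 ∧ ψ₀ ≫ ψ₀ = -(d • 𝟙 E₀) ∧
      ∀ N : ℕ, HodgeConjectureFor ((S.prod (E₀.prod E₀)).powSucc N).dim ((S.prod (E₀.prod E₀)).powSucc N).X := by
  obtain ⟨E₀, ψ₀, hE, hψ⟩ := Literature.NumberTheory.EllipticCurves.CMEndomorphism.exists_cmCurve_sqrt_neg d hW.d_pos
  exact ⟨E₀, ψ₀, hE, hψ, fun N => hodgeConjectureFor_powSucc_surface_prod_cmSquare_of_floccariFu h5 hW hE hψ N⟩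

end Summit.HodgeConjecture.HodgeConjecture.Ring2.AbelianAll

end
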